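import Literature.Analysis.FluidPDE.DEIJCascade
import HarnessLib

/-!
# Growth of the DEIJ cascade: the stage recursions and the uniform balanced-growth bound

Proof-support file for the discharge of `deij_anomalous_dissipation_eventually`
(`TurbPassiveScalar`), continuing `DEIJCascade`: the quantitative bookkeeping of
[cite: DrivasEtAl2022, Lemma 3.2 and §3.3] for the cascade `DEIJ.CascadeData`, in general
dimension and in `L²`-based quantities only. Everything is proved; the definitions are the
tracked numbers `a j = ‖∂_{p_j} g_j‖²` (source), `Pg j = ‖∇g_j‖²`, `S j = ‖hess g_j‖_{L²}`, the
ratio `ν j = N_j²/(ε_j a_j)` and the stage scalar `gb j b = g_j ∘ Φ_b`.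

* stage inequalities (from `DEIJStageStep`): `sq_mul_a_le` (`‖∂_q(g_j∘Φ_b)‖² ≥ (bN_j)²(1-8ε_j)a_j`),
  `scalarGradNormSq_gb_le` (`‖∇(g_j∘Φ_b)‖² ≤ 3P_j + 2(bN_j)²a_j`), `sqrt_hess_gb_le`
  (`‖hess(g_j∘Φ_b)‖ ≤ (1+bN_j)²S_j + bN_j²(32C_ψ²P_j/ε_j)^{1/2}`), conservation of `∫g²`;
* end-of-stage recursions: `K_sq_mul_a_le` (`a_{j+1} ≥ K_j²(1-8ε_j)a_j`, so `a_j ≥ (512r²)^j a_0`),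
  `Pg_succ_le`, `S_succ_le`;
* invariants, for constants dominating the initial ratios (`Pg_le`: `P_j ≤ ρ a_j`; `ν_le`:
  `ν_j ≤ ν_0`; `S_le`: `S_j ≤ U a_j`, by the linear potential `potential_bound` for the
  almost-geometric recursion `x_{j+1} ≤ (1 + 2^{-j}/8)x_j + γ2^{-j}`);
* **`sqrt_hess_gb_le_mul`**: the balanced-growth bound `‖hess g(t)‖_{L²} ≤ R‖∇g(t)‖²` at all
  times of the cascade, hence `integral_sq_laplacian_g_le`: `‖Δg(t)‖² ≤ (C₁‖∇g(t)‖²)²` — the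
  hypothesis of the criterion `DEIJ.le_eScalarDissipation_of_balanced_growth`
  [cite: DrivasEtAl2022, Lemma 3.2 (3.3)];
* **`exists_integral_ge`**: `∫₀ᵗ‖∇g‖² → ∞` as `t ↑ T` [cite: DrivasEtAl2022, Lemma 3.2 (3.4)],
  and `integral_sq_g` (the `L²` norm is conserved).

## References

* [DrivasEtAl2022] T. D. Drivas, T. M. Elgindi, G. Iyer, I.-J. Jeong, *Anomalous dissipation in
  passive scalar transport*, Arch. Ration. Mech. Anal. 243 (2022), arXiv:1911.03271, §3.2–3.3.
-/

noncomputable section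

open MeasureTheory TopologicalSpace Set Function Filter Topology UnitAddTorus
open scoped ENNReal NNReal InnerProductSpace ContDiff
open Literature.Analysis.FunctionSpaces.Torus
open Literature.Analysis.FunctionSpaces.Torus renaming partialDeriv → tPartialDeriv

namespace Literature.Analysis.FluidPDE

namespace Torus

namespace DEIJ

variable {d : Type*} [Fintype d] [DecidableEq d]

/-- **Upper bound for the driven derivative**: `‖∂_q(g∘Φ)‖² ≤ 2‖∂_q g‖² + 2∫φ'(x_q)²(∂_p g)²`
(from `∂_q(g∘Φ) = (∂_q g - φ'(x_q)∂_p g)∘Φ` and `(a-b)² ≤ 2a² + 2b²`). [folklore] -/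
theorem integral_sq_partialDeriv_comp_shearMap_le {p q : d} {g : UnitAddTorus d → ℝ} (hg : IsSmooth g)
    (hpq : p ≠ q) (P : ShearProfile) :
    ∫ x, tPartialDeriv q (g ∘ shearMap p q P) x ^ 2 ≤
      2 * (∫ x, tPartialDeriv q g x ^ 2) + 2 * ∫ x, P.D.onCircle (x q) ^ 2 * tPartialDeriv p g x ^ 2 := by
  set F : UnitAddTorus d → ℝ := fun z =>
    (tPartialDeriv q g z - P.D.onCircle (z q) * tPartialDeriv p g z) ^ 2 with hF
  have hpt : ∀ x, tPartialDeriv q (g ∘ shearMap p q P) x ^ 2 = F (shearMap p q P x) := by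
    intro x
    rw [partialDeriv_comp_shearMap_same hg P x, hF]
    simp only
    rw [shearMap_apply_of_ne P x (Ne.symm hpq)]
  simp_rw [hpt]
  rw [integral_comp_shearMap' hpq P F]
  have hc : Continuous fun z : UnitAddTorus d => P.D.onCircle (z q) := (isSmooth_onCircle_comp q P.D).continuous
  have hA : Continuous fun z => tPartialDeriv q g z := (hg.partialDeriv q).continuous
  have hB : Continuous fun z => tPartialDeriv p g z := (hg.partialDeriv p).continuous
  have h1 : Integrable (fun z => tPartialDeriv q g z ^ 2) volume := (hA.pow 2).integrable_unitAddTorus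
  have h3 : Integrable (fun z => P.D.onCircle (z q) ^ 2 * tPartialDeriv p g z ^ 2) volume :=
    ((hc.pow 2).mul (hB.pow 2)).integrable_unitAddTorus
  rw [← integral_const_mul, ← integral_const_mul, ← integral_add (h1.const_mul 2) (h3.const_mul 2)]
  refine integral_mono_of_nonneg (Eventually.of_forall fun z => sq_nonneg _) ((h1.const_mul 2).add (h3.const_mul 2))
    (Eventually.of_forall fun z => ?_)
  simp only [hF]
  nlinarith [sq_nonneg (tPartialDeriv q g z + P.D.onCircle (z q) * tPartialDeriv p g z)]

/-- With a slope bound `|φ'| ≤ K₁`: `‖∂_q(g∘Φ)‖² ≤ 2‖∂_q g‖² + 2K₁²‖∂_p g‖²`. [folklore] -/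
theorem integral_sq_partialDeriv_comp_shearMap_le' {p q : d} {g : UnitAddTorus d → ℝ} (hg : IsSmooth g)
    (hpq : p ≠ q) (P : ShearProfile) {K₁ : ℝ} (hK₁ : ∀ t, |deriv P t| ≤ K₁) :
    ∫ x, tPartialDeriv q (g ∘ shearMap p q P) x ^ 2 ≤
      2 * (∫ x, tPartialDeriv q g x ^ 2) + 2 * K₁ ^ 2 * ∫ x, tPartialDeriv p g x ^ 2 := by
  refine (integral_sq_partialDeriv_comp_shearMap_le hg hpq P).trans (add_le_add le_rfl ?_)
  rw [mul_assoc, ← integral_const_mul (K₁ ^ 2)]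
  have hB : Continuous fun z => tPartialDeriv p g z := (hg.partialDeriv p).continuous
  have hc : Continuous fun z : UnitAddTorus d => P.D.onCircle (z q) := (isSmooth_onCircle_comp q P.D).continuous
  refine mul_le_mul_of_nonneg_left (integral_mono (((hc.pow 2).mul (hB.pow 2)).integrable_unitAddTorus)
    (((hB.pow 2).integrable_unitAddTorus).const_mul _) fun z => ?_) two_pos.le
  refine mul_le_mul_of_nonneg_right ?_ (sq_nonneg _)
  have hb : |P.D.onCircle (z q)| ≤ K₁ := by
    induction z q using QuotientAddGroup.induction_on with
    | H t => rw [ShearProfile.onCircle_coe, ShearProfile.D_apply]; exact hK₁ t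
  rw [← sq_abs]
  exact pow_le_pow_left₀ (abs_nonneg _) hb 2

set_option maxSynthPendingDepth 2 in
/-- `(Δg)²` integrates to at most `(card d)² ∫‖hess g‖²`. [folklore] -/
theorem integral_sq_laplacian_le {g : UnitAddTorus d → ℝ} (hg : IsSmooth g) :
    ∫ x, laplacian g x ^ 2 ≤ (Fintype.card d : ℝ) ^ 2 * ∫ x, ‖hess g x‖ ^ 2 := by
  have hc : Continuous fun x => ‖hess g x‖ := (continuous_hess hg).norm
  have hi : Integrable (fun x => ‖hess g x‖ ^ 2) volume := (hc.pow 2).integrable_unitAddTorus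
  rw [← integral_const_mul]
  exact integral_mono_of_nonneg (Eventually.of_forall fun x => sq_nonneg _) (hi.const_mul _)
    (Eventually.of_forall fun x => sq_laplacian_le hg x)

namespace CascadeData

variable (D : CascadeData d)

/-! ## The tracked quantities -/

/-- The source `a_j = ‖∂_{p_j} g_j‖²_{L²}`. [folklore] -/
def a (j : ℕ) : ℝ := ∫ x, tPartialDeriv (D.pj j) (D.state j).g x ^ 2

/-- The gradient `P_j = ‖∇g_j‖²_{L²}`. [folklore] -/
def Pg (j : ℕ) : ℝ := scalarGradNormSq (D.state j).g

/-- The Hessian `S_j = ‖hess g_j‖_{L²}`. [folklore] -/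
def S (j : ℕ) : ℝ := Real.sqrt (∫ x, ‖hess (D.state j).g x‖ ^ 2)

/-- `a_zero` (a zero). [folklore] -/
theorem a_zero : D.a 0 = ∫ x, tPartialDeriv D.p₀ D.g₀ x ^ 2 := by simp [a, pj_zero, state_zero_g]

/-- `a_zero_pos` (a zero pos). [folklore] -/
theorem a_zero_pos : 0 < D.a 0 := by rw [a_zero]; exact D.source_pos

/-- `a_nonneg` (a nonneg). [folklore] -/
theorem a_nonneg (j : ℕ) : 0 ≤ D.a j := integral_nonneg fun _ => sq_nonneg _

/-- `Pg_nonneg` (Pg nonneg). [folklore] -/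
theorem Pg_nonneg (j : ℕ) : 0 ≤ D.Pg j := scalarGradNormSq_nonneg _

/-- `S_nonneg` (S nonneg). [folklore] -/
theorem S_nonneg (j : ℕ) : 0 ≤ D.S j := Real.sqrt_nonneg _

/-- `a_le_Pg` (a le Pg). [folklore] -/
theorem a_le_Pg (j : ℕ) : D.a j ≤ D.Pg j := integral_sq_partialDeriv_le_scalarGradNormSq (D.state j).hg _

/-- The scalar during stage `j` at amplitude `b`. [folklore] -/
def gb (j : ℕ) (b : ℝ) : UnitAddTorus d → ℝ :=
  (D.state j).g ∘ shearMap (D.pj j) (D.qj j) (ShearStage.amp (D.P j) b)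

/-- `isSmooth_gb` (isSmooth gb). [folklore] -/
theorem isSmooth_gb (j : ℕ) (b : ℝ) : IsSmooth (D.gb j b) := (D.state j).hg.comp_shearMap _ _ _

/-- `G_eq_gb` (G eq gb). [folklore] -/
theorem G_eq_gb (j : ℕ) (t : ℝ) : D.G j t = D.gb j (D.A j t) := rfl

/-- `state_succ_eq_gb` (state succ eq gb). [folklore] -/
theorem state_succ_eq_gb (j : ℕ) : (D.state (j + 1)).g = D.gb j (D.dur j) := rfl

/-! ## The stage inequalities -/

/-- `abs_deriv_amp_P_le` (abs deriv amp P le). [folklore] -/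
theorem abs_deriv_amp_P_le (j : ℕ) {b : ℝ} (hb : 0 ≤ b) (t : ℝ) :
    |deriv (ShearStage.amp (D.P j) b) t| ≤ b * D.Nf j := by
  have h := abs_deriv_amp_stageProfile_le (D.ε_pos j) (D.ε_le j) (D.Nf j) (D.sign_spec j (D.state j))
    (D.phase j (D.state j)) b t
  rw [abs_of_nonneg hb] at h
  exact h

/-- **Source growth during stage `j`**: `‖∂_{q_j}(g_j∘Φ_b)‖² ≥ (bN_j)²(1 - 8ε_j) a_j`. [folklore] -/
theorem sq_mul_a_le (j : ℕ) {b : ℝ} (hb : 0 ≤ b) :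
    (b * D.Nf j) ^ 2 * (1 - 8 * D.ε j) * D.a j ≤ ∫ x, tPartialDeriv (D.qj j) (D.gb j b) x ^ 2 :=
  sq_mul_integral_sq_partialDeriv_le (D.ε_pos j) (D.ε_le j) (D.state j).hg (D.pj_ne_qj j) (D.Nf j)
    (D.sign_spec j (D.state j)) hb (D.sign_mul_cross_nonpos j (D.state j)) (D.phase_spec j (D.state j)).1

/-- The gradient during a stage dominates the source. [folklore] -/
theorem a_le_scalarGradNormSq_gb (j : ℕ) (b : ℝ) : D.a j ≤ scalarGradNormSq (D.gb j b) :=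
  integral_sq_partialDeriv_le_scalarGradNormSq_comp (D.state j).hg (D.pj_ne_qj j) _

/-- The gradient during a stage dominates the grown source. [folklore] -/
theorem sq_mul_a_le_scalarGradNormSq_gb (j : ℕ) {b : ℝ} (hb : 0 ≤ b) :
    (b * D.Nf j) ^ 2 * (1 - 8 * D.ε j) * D.a j ≤ scalarGradNormSq (D.gb j b) :=
  (D.sq_mul_a_le j hb).trans (integral_sq_partialDeriv_comp_le_scalarGradNormSq (D.state j).hg _)

/-- `1 - 8ε_j ≥ 1/2`. [folklore] -/
theorem half_le_one_sub (j : ℕ) : 1 / 2 ≤ 1 - 8 * D.ε j := by linarith [D.ε_le j]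

/-- The gradient during a stage dominates `(bN)² a_j / 2`. [folklore] -/
theorem sq_mul_a_half_le (j : ℕ) {b : ℝ} (hb : 0 ≤ b) :
    (b * D.Nf j) ^ 2 * D.a j / 2 ≤ scalarGradNormSq (D.gb j b) := by
  have h := D.sq_mul_a_le_scalarGradNormSq_gb j hb
  have h2 := D.half_le_one_sub j
  nlinarith [sq_nonneg (b * D.Nf j), D.a_nonneg j, mul_nonneg (sq_nonneg (b * D.Nf j)) (D.a_nonneg j)]

/-- **Gradient upper bound during a stage**: `‖∇(g_j∘Φ_b)‖² ≤ 3P_j + 2(bN_j)² a_j`. [folklore] -/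
theorem scalarGradNormSq_gb_le (j : ℕ) {b : ℝ} (hb : 0 ≤ b) :
    scalarGradNormSq (D.gb j b) ≤ 3 * D.Pg j + 2 * (b * D.Nf j) ^ 2 * D.a j := by
  have h1 := scalarGradNormSq_comp_shearMap_le (D.state j).hg (D.pj_ne_qj j) (ShearStage.amp (D.P j) b)
  have h2 := integral_sq_partialDeriv_comp_shearMap_le' (D.state j).hg (D.pj_ne_qj j) (ShearStage.amp (D.P j) b)
    (fun t => D.abs_deriv_amp_P_le j hb t)
  have h3 : ∫ x, tPartialDeriv (D.qj j) (D.state j).g x ^ 2 ≤ D.Pg j :=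
    integral_sq_partialDeriv_le_scalarGradNormSq (D.state j).hg _
  unfold gb Pg at *
  unfold a
  linarith

/-- **Hessian bound during a stage**:
`‖hess(g_j∘Φ_b)‖_{L²} ≤ (1 + bN_j)² S_j + bN_j² (32C_ψ²P_j/ε_j)^{1/2}`. [folklore] -/
theorem sqrt_hess_gb_le (j : ℕ) {b : ℝ} (hb : 0 ≤ b) :
    Real.sqrt (∫ x, ‖hess (D.gb j b) x‖ ^ 2) ≤
      (1 + b * D.Nf j) ^ 2 * D.S j + b * (D.Nf j) ^ 2 * Real.sqrt (32 * ShearCascade.Cψ1 ^ 2 / D.ε j * D.Pg j) :=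
  sqrt_integral_hess_comp_stage_le (D.ε_pos j) (D.ε_le j) (D.state j).hg (D.pj_ne_qj j) (D.Nf j)
    (D.sign_spec j (D.state j)) hb (D.phase_spec j (D.state j)).2

/-- The `L²` norm is conserved along the cascade. [folklore] -/
theorem integral_sq_gb (j : ℕ) (b : ℝ) : ∫ x, D.gb j b x ^ 2 = ∫ x, (D.state j).g x ^ 2 :=
  integral_sq_comp_shearMap (D.pj_ne_qj j) _ _

/-- `integral_sq_state` (integral sq state). [folklore] -/
theorem integral_sq_state (j : ℕ) : ∫ x, (D.state j).g x ^ 2 = ∫ x, D.g₀ x ^ 2 := by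
  induction j with
  | zero => rfl
  | succ j ih => rw [state_succ_eq_gb, integral_sq_gb, ih]

/-! ## The end-of-stage recursions -/

/-- `a_succ_eq` (a succ eq). [folklore] -/
theorem a_succ_eq (j : ℕ) : D.a (j + 1) = ∫ x, tPartialDeriv (D.qj j) (D.gb j (D.dur j)) x ^ 2 := by
  unfold a; rw [pj_succ]; rfl

/-- **(E1)** `a_{j+1} ≥ K_j²(1 - 8ε_j) a_j`. [folklore] -/
theorem K_sq_mul_a_le (j : ℕ) : D.K j ^ 2 * (1 - 8 * D.ε j) * D.a j ≤ D.a (j + 1) := by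
  rw [a_succ_eq]; exact D.sq_mul_a_le j (D.dur_pos j).le

/-- `a_{j+1} ≥ K_j² a_j / 2`. [folklore] -/
theorem K_sq_mul_a_half_le (j : ℕ) : D.K j ^ 2 * D.a j / 2 ≤ D.a (j + 1) := by
  have h := D.K_sq_mul_a_le j
  have h2 := D.half_le_one_sub j
  nlinarith [sq_nonneg (D.K j), D.a_nonneg j, mul_nonneg (sq_nonneg (D.K j)) (D.a_nonneg j)]

/-- The sources are positive. [folklore] -/
theorem a_pos (j : ℕ) : 0 < D.a j := by
  induction j with
  | zero => exact D.a_zero_pos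
  | succ j ih =>
    refine lt_of_lt_of_le ?_ (D.K_sq_mul_a_half_le j)
    have := D.K_pos j
    positivity

/-- The sources increase (fast): `a_{j+1} ≥ 512 r² a_j`. [folklore] -/
theorem mul_a_le_a_succ (j : ℕ) : 512 * D.r ^ 2 * D.a j ≤ D.a (j + 1) := by
  refine le_trans ?_ (D.K_sq_mul_a_half_le j)
  have hK := D.le_K j
  have h2 : (2 : ℝ) ≤ 2 ^ (j + 1) := by
    have := one_le_pow₀ (M₀ := ℝ) (a := 2) (n := j) (by norm_num); rw [pow_succ]; linarith
  have hK' : 32 * D.r ≤ D.K j := by nlinarith [D.r_pos]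
  have ha := (D.a_pos j).le
  have hK2 : 1024 * D.r ^ 2 ≤ D.K j ^ 2 := by nlinarith [D.r_pos]
  nlinarith [mul_le_mul_of_nonneg_right hK2 ha]

/-- `a_mono` (a mono). [folklore] -/
theorem a_mono (j : ℕ) : D.a j ≤ D.a (j + 1) := by
  have h := D.mul_a_le_a_succ j
  have h2 : (1 : ℝ) ≤ 512 * D.r ^ 2 := by nlinarith [D.two_le_r]
  nlinarith [D.a_pos j]

/-- `a_zero_le` (a zero le). [folklore] -/
theorem a_zero_le (j : ℕ) : D.a 0 ≤ D.a j := by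
  induction j with
  | zero => exact le_rfl
  | succ j ih => exact ih.trans (D.a_mono j)

/-- `a_j ≥ (512 r²)^j a_0`. [folklore] -/
theorem pow_mul_a_zero_le (j : ℕ) : (512 * D.r ^ 2) ^ j * D.a 0 ≤ D.a j := by
  induction j with
  | zero => simp
  | succ j ih =>
    refine le_trans ?_ (D.mul_a_le_a_succ j)
    rw [pow_succ]
    have h0 : 0 ≤ 512 * D.r ^ 2 := by positivity
    nlinarith

/-- **(E2)** `P_{j+1} ≤ 3P_j + 2K_j² a_j`. [folklore] -/
theorem Pg_succ_le (j : ℕ) : D.Pg (j + 1) ≤ 3 * D.Pg j + 2 * D.K j ^ 2 * D.a j := by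
  have h := D.scalarGradNormSq_gb_le j (D.dur_pos j).le
  unfold Pg; rw [state_succ_eq_gb]; unfold K; exact h

/-- **(E3)** `S_{j+1} ≤ (1 + K_j)² S_j + K_j N_j (32C_ψ²P_j/ε_j)^{1/2}`. [folklore] -/
theorem S_succ_le (j : ℕ) :
    D.S (j + 1) ≤ (1 + D.K j) ^ 2 * D.S j + D.K j * D.Nf j * Real.sqrt (32 * ShearCascade.Cψ1 ^ 2 / D.ε j * D.Pg j) := by
  have h := D.sqrt_hess_gb_le j (D.dur_pos j).le
  have e : D.S (j + 1) = Real.sqrt (∫ x, ‖hess (D.gb j (D.dur j)) x‖ ^ 2) := rfl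
  rw [e]; unfold K
  calc _ ≤ _ := h
    _ = _ := by ring

/-! ## Elementary recursions -/

/-- **A linear potential for almost-geometric recursions.** If
`x_{j+1} ≤ (1 + δ2^{-j}) x_j + γ2^{-j}` with `x_0 ≤ U/2` and `2δ + 2γ/U ≤ 1/2`, then
`x_j ≤ U(1 - (2δ + 2γ/U)2^{-j}) ≤ U` for all `j`. [folklore] -/
theorem potential_bound {x : ℕ → ℝ} {δ γ U : ℝ} (hU : 0 < U) (hδ : 0 ≤ δ) (hγ : 0 ≤ γ)
    (hc : 2 * δ + 2 * γ / U ≤ 1 / 2) (h0 : x 0 ≤ U / 2)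
    (hstep : ∀ j, x (j + 1) ≤ (1 + δ * 2⁻¹ ^ j) * x j + γ * 2⁻¹ ^ j) (j : ℕ) :
    x j ≤ U * (1 - (2 * δ + 2 * γ / U) * 2⁻¹ ^ j) := by
  set c := 2 * δ + 2 * γ / U with hcdef
  have hc0 : 0 ≤ c := by positivity
  have hUc : U * c = 2 * (U * δ + γ) := by simp only [hcdef]; field_simp
  induction j with
  | zero => simp only [pow_zero, mul_one]; nlinarith
  | succ j ih =>
    have hy0 : 0 < (2⁻¹ : ℝ) ^ j := by positivity
    have hy1 : (2⁻¹ : ℝ) ^ j ≤ 1 := pow_le_one₀ (by norm_num) (by norm_num)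
    have hstep' := hstep j
    rw [pow_succ]
    set y := (2⁻¹ : ℝ) ^ j with hy
    have h1 : (1 + δ * y) * x j ≤ (1 + δ * y) * (U * (1 - c * y)) :=
      mul_le_mul_of_nonneg_left ih (by positivity)
    have key : (1 + δ * y) * (U * (1 - c * y)) + γ * y ≤ U * (1 - c * (y * 2⁻¹)) := by
      have e : U * (1 - c * (y * 2⁻¹)) - ((1 + δ * y) * (U * (1 - c * y)) + γ * y) =
          y * (U * c / 2 - U * δ - γ) + U * δ * c * y ^ 2 := by ring
      have h2 : U * c / 2 - U * δ - γ = 0 := by rw [hUc]; ring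
      have h3 : 0 ≤ U * δ * c * y ^ 2 := by positivity
      nlinarith
    linarith

/-- A bounded-ratio recursion: `ρ_{j+1} ≤ ρ_j/2 + 4` keeps `ρ_j ≤ max ρ_0 8`. [folklore] -/
theorem ratio_bound {ρ : ℕ → ℝ} (hstep : ∀ j, ρ (j + 1) ≤ ρ j / 2 + 4) (j : ℕ) : ρ j ≤ max (ρ 0) 8 := by
  induction j with
  | zero => exact le_max_left _ _
  | succ j ih =>
    have h8 : (8 : ℝ) ≤ max (ρ 0) 8 := le_max_right _ _
    linarith [hstep j]

/-- The factor of the Hessian recursion: `(1 + K)² ≤ (1 + y/8) K² (1 - y/32)` whenever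
`K y ≥ 64`, `0 < y ≤ 1`. [folklore] -/
theorem hess_factor_le {K y : ℝ} (hK : 0 < K) (hy0 : 0 < y) (hy1 : y ≤ 1) (hKy : 64 ≤ K * y) :
    (1 + K) ^ 2 ≤ (1 + y / 8) * (K ^ 2 * (1 - y / 32)) := by
  have hK64 : 64 ≤ K := by nlinarith
  have h1 : 1 + 23 * y / 256 ≤ (1 + y / 8) * (1 - y / 32) := by nlinarith
  have h2 : K ^ 2 * (1 + 23 * y / 256) ≤ K ^ 2 * ((1 + y / 8) * (1 - y / 32)) :=
    mul_le_mul_of_nonneg_left h1 (sq_nonneg K)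
  have h3 : K ^ 2 * (1 + 23 * y / 256) = K ^ 2 + 23 / 256 * K * (K * y) := by ring
  have h4 : 23 / 256 * K * 64 ≤ 23 / 256 * K * (K * y) := mul_le_mul_of_nonneg_left hKy (by positivity)
  nlinarith

/-! ## The invariants of the cascade

All bounds are stated for arbitrary constants satisfying explicit sufficient conditions in terms of
the initial ratios `P_0/a_0`, `N_0²/(ε_0 a_0)`, `S_0/a_0` (so that they can be chosen uniformly
along an approximating family of data). -/

section Invariants

variable {ρ Wc U R : ℝ}

/-- **(Ib)** the gradient is comparable to the source: `P_j ≤ ρ a_j` whenever `ρ ≥ 8` and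
`P_0 ≤ ρ a_0`. [folklore] -/
theorem Pg_le (hρ8 : 8 ≤ ρ) (hρ0 : D.Pg 0 ≤ ρ * D.a 0) (j : ℕ) : D.Pg j ≤ ρ * D.a j := by
  induction j with
  | zero => exact hρ0
  | succ j ih =>
    have h1 := D.Pg_succ_le j
    have h2 := D.K_sq_mul_a_half_le j
    have hK : 16 ≤ D.K j := D.sixteen_le_K j
    have hK2 : 256 ≤ D.K j ^ 2 := by nlinarith
    have ha := (D.a_pos j).le
    have hρ : 0 ≤ ρ := by linarith
    have h3 : 3 * ρ + 2 * D.K j ^ 2 ≤ ρ * D.K j ^ 2 / 2 := by nlinarith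
    have h4 : D.Pg (j + 1) ≤ (3 * ρ + 2 * D.K j ^ 2) * D.a j := by nlinarith
    have h5 : (3 * ρ + 2 * D.K j ^ 2) * D.a j ≤ ρ * D.K j ^ 2 / 2 * D.a j := mul_le_mul_of_nonneg_right h3 ha
    have h6 : ρ * D.K j ^ 2 / 2 * D.a j ≤ ρ * D.a (j + 1) := by
      have := mul_le_mul_of_nonneg_left h2 hρ
      linarith
    linarith

/-- The frequency-to-source ratio `ν_j = N_j²/(ε_j a_j)`. [folklore] -/
def ν (j : ℕ) : ℝ := (D.Nf j : ℝ) ^ 2 / (D.ε j * D.a j)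

/-- `ν_nonneg` (ν nonneg). [folklore] -/
theorem ν_nonneg (j : ℕ) : 0 ≤ D.ν j := by
  unfold ν; exact div_nonneg (sq_nonneg _) (mul_nonneg (D.ε_pos j).le (D.a_pos j).le)

/-- `ν_zero` (ν zero). [folklore] -/
theorem ν_zero : D.ν 0 = 256 * (D.N₀ * (2 * D.r)) ^ 2 / D.a 0 := by
  unfold ν; rw [cast_Nf, ε_zero]; ring

/-- **(Ic)** `ν_{j+1} ≤ ν_j` (the source grows faster than `N²/ε`). [folklore] -/
theorem ν_succ_le (j : ℕ) : D.ν (j + 1) ≤ D.ν j := by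
  unfold ν
  rw [cast_Nf_succ, ε_succ]
  have ha := D.a_pos j
  have ha1 := D.a_pos (j + 1)
  have hε := D.ε_pos j
  have h2 := D.K_sq_mul_a_half_le j
  have hK : 16 * D.r * 2 ^ (j + 1) ≤ D.K j := D.le_K j
  have h4r : 4 * D.r ≤ D.K j := by
    have : (2 : ℝ) ≤ 2 ^ (j + 1) := by
      have := one_le_pow₀ (M₀ := ℝ) (a := 2) (n := j) (by norm_num); rw [pow_succ]; linarith
    nlinarith [D.r_pos]
  rw [div_le_div_iff₀ (by positivity) (by positivity)]
  have hK2 : 16 * D.r ^ 2 ≤ D.K j ^ 2 := by nlinarith [D.r_pos]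
  have h5 : 8 * D.r ^ 2 * D.a j ≤ D.a (j + 1) := by nlinarith
  have hN : 0 ≤ (D.Nf j : ℝ) ^ 2 * D.ε j := by positivity
  nlinarith [mul_le_mul_of_nonneg_left h5 hN]

/-- `ν_le` (ν le). [folklore] -/
theorem ν_le (j : ℕ) : D.ν j ≤ D.ν 0 := by
  induction j with
  | zero => exact le_rfl
  | succ j ih => exact (D.ν_succ_le j).trans ih

/-- **The curvature weight is controlled by the source**: `N_j² P_j/ε_j ≤ W² a_j²` whenever
`W² ≥ ν_0 ρ`. [folklore] -/
theorem Nf_sq_mul_Pg_div_le (hρ8 : 8 ≤ ρ) (hρ0 : D.Pg 0 ≤ ρ * D.a 0) (hW : D.ν 0 * ρ ≤ Wc ^ 2) (j : ℕ) :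
    (D.Nf j : ℝ) ^ 2 * D.Pg j / D.ε j ≤ Wc ^ 2 * D.a j ^ 2 := by
  have hν := D.ν_le j
  have hP := D.Pg_le hρ8 hρ0 j
  have ha := D.a_pos j
  have hε := D.ε_pos j
  have hρ : 0 < ρ := by linarith
  have e : (D.Nf j : ℝ) ^ 2 * D.Pg j / D.ε j = D.ν j * D.a j * D.Pg j := by
    unfold ν; field_simp
  rw [e]
  have h1 : D.ν j * D.a j * D.Pg j ≤ D.ν j * D.a j * (ρ * D.a j) :=
    mul_le_mul_of_nonneg_left hP (mul_nonneg (D.ν_nonneg j) ha.le)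
  have h2 : D.ν j * D.a j * (ρ * D.a j) ≤ D.ν 0 * D.a j * (ρ * D.a j) := by
    have : 0 ≤ D.a j * (ρ * D.a j) := by positivity
    nlinarith
  have h3 : D.ν 0 * D.a j * (ρ * D.a j) = (D.ν 0 * ρ) * D.a j ^ 2 := by ring
  have h4 : (D.ν 0 * ρ) * D.a j ^ 2 ≤ Wc ^ 2 * D.a j ^ 2 := mul_le_mul_of_nonneg_right hW (sq_nonneg _)
  linarith

/-- `N_j (32 C_ψ² P_j/ε_j)^{1/2} ≤ 8 C_ψ W a_j`. [folklore] -/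
theorem Nf_mul_sqrt_le (hρ8 : 8 ≤ ρ) (hρ0 : D.Pg 0 ≤ ρ * D.a 0) (hW0 : 0 ≤ Wc) (hW : D.ν 0 * ρ ≤ Wc ^ 2) (j : ℕ) :
    (D.Nf j : ℝ) * Real.sqrt (32 * ShearCascade.Cψ1 ^ 2 / D.ε j * D.Pg j) ≤ 8 * ShearCascade.Cψ1 * Wc * D.a j := by
  obtain ⟨hC0, -⟩ := ShearCascade.Cψ1_spec
  have hN : 0 ≤ (D.Nf j : ℝ) := Nat.cast_nonneg _
  have ha := (D.a_pos j).le
  rw [← Real.sqrt_sq hN, ← Real.sqrt_mul (sq_nonneg _)]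
  have h1 : (D.Nf j : ℝ) ^ 2 * (32 * ShearCascade.Cψ1 ^ 2 / D.ε j * D.Pg j) =
      32 * ShearCascade.Cψ1 ^ 2 * ((D.Nf j : ℝ) ^ 2 * D.Pg j / D.ε j) := by ring
  rw [h1]
  have h2 : 32 * ShearCascade.Cψ1 ^ 2 * ((D.Nf j : ℝ) ^ 2 * D.Pg j / D.ε j) ≤ (8 * ShearCascade.Cψ1 * Wc * D.a j) ^ 2 := by
    have h := D.Nf_sq_mul_Pg_div_le hρ8 hρ0 hW j
    have h' : 0 ≤ ShearCascade.Cψ1 ^ 2 * (Wc ^ 2 * D.a j ^ 2) := by positivity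
    nlinarith
  calc Real.sqrt (32 * ShearCascade.Cψ1 ^ 2 * ((D.Nf j : ℝ) ^ 2 * D.Pg j / D.ε j))
      ≤ Real.sqrt ((8 * ShearCascade.Cψ1 * Wc * D.a j) ^ 2) := Real.sqrt_le_sqrt h2
    _ = 8 * ShearCascade.Cψ1 * Wc * D.a j := Real.sqrt_sq (by positivity)

/-- **The Hessian recursion in ratio form**: with `x_j = S_j/a_j`,
`x_{j+1} ≤ (1 + 2^{-j}/8) x_j + (C_ψ W/4) 2^{-j}`. [folklore] -/
theorem S_div_a_succ_le (hρ8 : 8 ≤ ρ) (hρ0 : D.Pg 0 ≤ ρ * D.a 0) (hW0 : 0 ≤ Wc) (hW : D.ν 0 * ρ ≤ Wc ^ 2) (j : ℕ) :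
    D.S (j + 1) / D.a (j + 1) ≤ (1 + 1 / 8 * 2⁻¹ ^ j) * (D.S j / D.a j) + ShearCascade.Cψ1 * Wc / 4 * 2⁻¹ ^ j := by
  obtain ⟨hC0, -⟩ := ShearCascade.Cψ1_spec
  have ha := D.a_pos j
  have ha1 := D.a_pos (j + 1)
  have hK := D.K_pos j
  have hS := D.S_nonneg j
  set y : ℝ := 2⁻¹ ^ j with hy
  have hy0 : 0 < y := by positivity
  have hy1 : y ≤ 1 := pow_le_one₀ (by norm_num) (by norm_num)
  have hyy : y * 2 ^ j = 1 := by rw [hy, inv_pow, inv_mul_cancel₀ (by positivity)]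
  have h1 := D.S_succ_le j
  have h2 := D.K_sq_mul_a_le j
  have h8ε : 8 * D.ε j = y / 32 := by rw [D.eight_mul_ε j, hy]
  have h1mε : 1 - 8 * D.ε j = 1 - y / 32 := by rw [h8ε]
  rw [h1mε] at h2
  have hKy : 64 ≤ D.K j * y := by
    have h := D.le_K' j
    calc (64 : ℝ) = 64 * 2 ^ j * y := by rw [mul_assoc, mul_comm _ y, hyy, mul_one]
      _ ≤ D.K j * y := mul_le_mul_of_nonneg_right h hy0.le
  have hfac := hess_factor_le hK hy0 hy1 hKy
  have h3 := D.Nf_mul_sqrt_le hρ8 hρ0 hW0 hW j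
  have h4 : D.S (j + 1) ≤ (1 + D.K j) ^ 2 * D.S j + D.K j * (8 * ShearCascade.Cψ1 * Wc * D.a j) := by
    have := mul_le_mul_of_nonneg_left h3 hK.le
    linarith
  rw [div_le_iff₀ ha1]
  refine h4.trans ?_
  have h5 : ((1 + 1 / 8 * y) * (D.S j / D.a j) + ShearCascade.Cψ1 * Wc / 4 * y) * (D.K j ^ 2 * (1 - y / 32) * D.a j) ≤
      ((1 + 1 / 8 * y) * (D.S j / D.a j) + ShearCascade.Cψ1 * Wc / 4 * y) * D.a (j + 1) :=
    mul_le_mul_of_nonneg_left h2 (by positivity)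
  refine le_trans ?_ h5
  have e : ((1 + 1 / 8 * y) * (D.S j / D.a j) + ShearCascade.Cψ1 * Wc / 4 * y) * (D.K j ^ 2 * (1 - y / 32) * D.a j) =
      (1 + y / 8) * (D.K j ^ 2 * (1 - y / 32)) * D.S j +
        ShearCascade.Cψ1 * Wc / 4 * y * (D.K j ^ 2 * (1 - y / 32)) * D.a j := by
    field_simp
  rw [e]
  refine add_le_add (mul_le_mul_of_nonneg_right hfac hS) ?_
  have h6 : 32 ≤ y * D.K j * (1 - y / 32) := by nlinarith
  have h7 : 0 ≤ ShearCascade.Cψ1 * Wc * D.a j := by positivity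
  nlinarith [mul_le_mul_of_nonneg_left h6 h7]

/-- **(Id)** the Hessian is comparable to the source: `S_j ≤ U a_j` whenever `U ≥ 1`,
`U a_0 ≥ 2 S_0` and `U ≥ 2 C_ψ W`. [folklore] -/
theorem S_le (hρ8 : 8 ≤ ρ) (hρ0 : D.Pg 0 ≤ ρ * D.a 0) (hW0 : 0 ≤ Wc) (hW : D.ν 0 * ρ ≤ Wc ^ 2)
    (hU1 : 1 ≤ U) (hUS : 2 * D.S 0 ≤ U * D.a 0) (hUW : 2 * ShearCascade.Cψ1 * Wc ≤ U) (j : ℕ) :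
    D.S j ≤ U * D.a j := by
  obtain ⟨hC0, -⟩ := ShearCascade.Cψ1_spec
  have hU : 0 < U := by linarith
  have hγ : 0 ≤ ShearCascade.Cψ1 * Wc / 4 := by positivity
  have h := potential_bound (x := fun j => D.S j / D.a j) (δ := 1 / 8) (γ := ShearCascade.Cψ1 * Wc / 4) (U := U)
    hU (by norm_num) hγ ?_ ?_ (fun j => D.S_div_a_succ_le hρ8 hρ0 hW0 hW j) j
  · have hc : 0 ≤ (2 * (1 / 8) + 2 * (ShearCascade.Cψ1 * Wc / 4) / U) * 2⁻¹ ^ j := by positivity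
    have h' : D.S j / D.a j ≤ U := by nlinarith
    rwa [div_le_iff₀ (D.a_pos j)] at h'
  · have : 2 * (ShearCascade.Cψ1 * Wc / 4) / U ≤ 1 / 4 := by rw [div_le_iff₀ hU]; linarith
    linarith
  · show D.S 0 / D.a 0 ≤ U / 2
    rw [div_le_iff₀ D.a_zero_pos]; linarith

/-! ## The uniform balanced-growth bound -/

/-- **Balanced growth during every stage**: `‖hess(g_j∘Φ_b)‖_{L²} ≤ R ‖∇(g_j∘Φ_b)‖²_{L²}` for
`0 ≤ b`, whenever `R ≥ 8U + 12 C_ψ W`. [cite: DrivasEtAl2022, Lemma 3.2 (3.3) with Lemma 3.4] -/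
theorem sqrt_hess_gb_le_mul (hρ8 : 8 ≤ ρ) (hρ0 : D.Pg 0 ≤ ρ * D.a 0) (hW0 : 0 ≤ Wc) (hW : D.ν 0 * ρ ≤ Wc ^ 2)
    (hU1 : 1 ≤ U) (hUS : 2 * D.S 0 ≤ U * D.a 0) (hUW : 2 * ShearCascade.Cψ1 * Wc ≤ U)
    (hR : 8 * U + 12 * ShearCascade.Cψ1 * Wc ≤ R) (j : ℕ) {b : ℝ} (hb : 0 ≤ b) :
    Real.sqrt (∫ x, ‖hess (D.gb j b) x‖ ^ 2) ≤ R * scalarGradNormSq (D.gb j b) := by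
  obtain ⟨hC0, -⟩ := ShearCascade.Cψ1_spec
  have h := D.sqrt_hess_gb_le j hb
  set P' := scalarGradNormSq (D.gb j b) with hP'
  have hP0 : 0 ≤ P' := scalarGradNormSq_nonneg _
  have hP1 : D.a j ≤ P' := D.a_le_scalarGradNormSq_gb j b
  have hP2 : (b * D.Nf j) ^ 2 * D.a j / 2 ≤ P' := D.sq_mul_a_half_le j hb
  have ha := (D.a_pos j).le
  have hS := D.S_le hρ8 hρ0 hW0 hW hU1 hUS hUW j
  have hU : 0 ≤ U := by linarith
  have hN : 0 ≤ (D.Nf j : ℝ) := Nat.cast_nonneg _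
  have hbN : 0 ≤ b * D.Nf j := mul_nonneg hb hN
  refine h.trans ?_
  have hT1 : (1 + b * D.Nf j) ^ 2 * D.S j ≤ 8 * U * P' := by
    have h1 : (1 + b * D.Nf j) ^ 2 * D.S j ≤ (1 + b * D.Nf j) ^ 2 * (U * D.a j) :=
      mul_le_mul_of_nonneg_left hS (sq_nonneg _)
    have h2 : (1 + b * D.Nf j) ^ 2 * D.a j ≤ 6 * P' := by nlinarith [sq_nonneg (1 - b * D.Nf j)]
    nlinarith [mul_le_mul_of_nonneg_left h2 hU]
  have hT2 : b * (D.Nf j : ℝ) ^ 2 * Real.sqrt (32 * ShearCascade.Cψ1 ^ 2 / D.ε j * D.Pg j) ≤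
      12 * ShearCascade.Cψ1 * Wc * P' := by
    have h3 := D.Nf_mul_sqrt_le hρ8 hρ0 hW0 hW j
    have e : b * (D.Nf j : ℝ) ^ 2 * Real.sqrt (32 * ShearCascade.Cψ1 ^ 2 / D.ε j * D.Pg j) =
        (b * D.Nf j) * ((D.Nf j : ℝ) * Real.sqrt (32 * ShearCascade.Cψ1 ^ 2 / D.ε j * D.Pg j)) := by ring
    rw [e]
    have h4 : (b * D.Nf j) * ((D.Nf j : ℝ) * Real.sqrt (32 * ShearCascade.Cψ1 ^ 2 / D.ε j * D.Pg j)) ≤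
        (b * D.Nf j) * (8 * ShearCascade.Cψ1 * Wc * D.a j) := mul_le_mul_of_nonneg_left h3 hbN
    have h5 : b * D.Nf j * D.a j ≤ 3 / 2 * P' := by nlinarith [sq_nonneg (1 - b * D.Nf j)]
    have h6 : 0 ≤ ShearCascade.Cψ1 * Wc := mul_nonneg hC0 hW0
    nlinarith [mul_le_mul_of_nonneg_left h5 h6]
  have hR' : (8 * U + 12 * ShearCascade.Cψ1 * Wc) * P' ≤ R * P' := mul_le_mul_of_nonneg_right hR hP0
  nlinarith

/-- The inviscid scalar at time `t` is the stage scalar at the current amplitude. [folklore] -/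
theorem g_eq_gb (t : ℝ) : D.g t = D.gb (D.idx t) (D.A (D.idx t) t) := rfl

/-- **Balanced growth of the inviscid scalar**: `‖Δg(t)‖²_{L²} ≤ (C₁ ‖∇g(t)‖²)²` at every time,
for `C₁ ≥ card d · R`. [cite: DrivasEtAl2022, Lemma 3.2 (3.3) / Prop. 1.3 hypothesis] -/
theorem integral_sq_laplacian_g_le (hρ8 : 8 ≤ ρ) (hρ0 : D.Pg 0 ≤ ρ * D.a 0) (hW0 : 0 ≤ Wc) (hW : D.ν 0 * ρ ≤ Wc ^ 2)
    (hU1 : 1 ≤ U) (hUS : 2 * D.S 0 ≤ U * D.a 0) (hUW : 2 * ShearCascade.Cψ1 * Wc ≤ U)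
    (hR : 8 * U + 12 * ShearCascade.Cψ1 * Wc ≤ R) {C₁ : ℝ} (hC₁ : (Fintype.card d : ℝ) * R ≤ C₁) (t : ℝ) :
    ∫ x, laplacian (D.g t) x ^ 2 ≤ (C₁ * scalarGradNormSq (D.g t)) ^ 2 := by
  rw [g_eq_gb]
  set k := D.idx t
  set b := D.A k t
  have hb : 0 ≤ b := D.A_nonneg k t
  have h1 := integral_sq_laplacian_le (D.isSmooth_gb k b)
  have h2 := D.sqrt_hess_gb_le_mul hρ8 hρ0 hW0 hW hU1 hUS hUW hR k hb
  have hP0 : 0 ≤ scalarGradNormSq (D.gb k b) := scalarGradNormSq_nonneg _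
  have hR0 : 0 ≤ R := by
    obtain ⟨hC0, -⟩ := ShearCascade.Cψ1_spec
    nlinarith [mul_nonneg hC0 hW0]
  have h0 : 0 ≤ ∫ x, ‖hess (D.gb k b) x‖ ^ 2 := integral_nonneg fun x => sq_nonneg _
  have h3 : ∫ x, ‖hess (D.gb k b) x‖ ^ 2 ≤ (R * scalarGradNormSq (D.gb k b)) ^ 2 := by
    rw [← Real.sq_sqrt h0]
    exact pow_le_pow_left₀ (Real.sqrt_nonneg _) h2 2
  have h4 : (Fintype.card d : ℝ) * (R * scalarGradNormSq (D.gb k b)) ≤ C₁ * scalarGradNormSq (D.gb k b) := by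
    rw [← mul_assoc]; exact mul_le_mul_of_nonneg_right hC₁ hP0
  calc ∫ x, laplacian (D.gb k b) x ^ 2 ≤ (Fintype.card d : ℝ) ^ 2 * ∫ x, ‖hess (D.gb k b) x‖ ^ 2 := h1
    _ ≤ (Fintype.card d : ℝ) ^ 2 * (R * scalarGradNormSq (D.gb k b)) ^ 2 :=
        mul_le_mul_of_nonneg_left h3 (sq_nonneg _)
    _ = ((Fintype.card d : ℝ) * (R * scalarGradNormSq (D.gb k b))) ^ 2 := by ring
    _ ≤ (C₁ * scalarGradNormSq (D.gb k b)) ^ 2 :=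
        pow_le_pow_left₀ (by positivity) h4 2

end Invariants

/-- **Conservation of the `L²` norm of the inviscid scalar.** [folklore] -/
theorem integral_sq_g (t : ℝ) : ∫ x, D.g t x ^ 2 = ∫ x, D.g₀ x ^ 2 := by
  rw [g_eq_gb, integral_sq_gb, integral_sq_state]

/-- `g_zero` (g zero). [folklore] -/
theorem g_zero : D.g 0 = D.g₀ := by
  have h0 : D.idx 0 = 0 := D.idx_eq D.T_pos (Or.inl rfl) (by rw [Tst_succ, Tst_zero, zero_add]; exact D.dur_pos 0)
  unfold g; rw [h0, D.G_eq_state (by rw [Tst_zero])]; rfl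

/-! ## Unbounded growth of the time-integrated gradient -/

/-- The gradient norm of the inviscid scalar is continuous in time on `(-∞, T)`. [folklore] -/
theorem continuousOn_scalarGradNormSq_g : ContinuousOn (fun t => scalarGradNormSq (D.g t)) (Iio D.T) := by
  have hg := D.isSmoothSpaceTimeOn_g_Iio
  have hgr := hg.gradient (uniqueDiffOn_Iio D.T)
  have hφ := hgr.inner hgr
  have hc := hφ.continuousOn_integral (convex_Iio _)
  refine hc.congr fun t _ => ?_
  simp only [scalarGradNormSq, real_inner_self_eq_norm_sq]

/-- `intervalIntegrable_scalarGradNormSq_g` (intervalIntegrable scalarGradNormSq g). [folklore] -/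
theorem intervalIntegrable_scalarGradNormSq_g {a b : ℝ} (hab : a ≤ b) (hb : b < D.T) :
    IntervalIntegrable (fun t => scalarGradNormSq (D.g t)) volume a b := by
  refine ContinuousOn.intervalIntegrable ?_
  rw [uIcc_of_le hab]
  exact D.continuousOn_scalarGradNormSq_g.mono fun t ht => lt_of_le_of_lt ht.2 hb

/-- On the second half of stage `k` the inviscid scalar is already the next state. [folklore] -/
theorem g_eq_state_succ {k : ℕ} {t : ℝ} (h1 : D.Tst k + D.dur k / 2 < t) (h2 : t ≤ D.Tst (k + 1)) :
    D.g t = (D.state (k + 1)).g := by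
  have hmem : t ∈ D.piece (k + 1) := ⟨h1, lt_of_le_of_lt h2 (D.Tst_lt_Tst_succ _)⟩
  rw [D.g_eq_of_mem_piece hmem, D.G_eq_state h2]

/-- **The time integral over the second half of stage `k`** is `(t_k/2) P_{k+1}`. [folklore] -/
theorem integral_second_half (k : ℕ) :
    ∫ t in (D.Tst k + D.dur k / 2)..D.Tst (k + 1), scalarGradNormSq (D.g t) = D.dur k / 2 * D.Pg (k + 1) := by
  have hle : D.Tst k + D.dur k / 2 ≤ D.Tst (k + 1) := (D.Tst_add_half_lt k).le
  have h : ∫ t in (D.Tst k + D.dur k / 2)..D.Tst (k + 1), scalarGradNormSq (D.g t) =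
      ∫ t in (D.Tst k + D.dur k / 2)..D.Tst (k + 1), D.Pg (k + 1) := by
    refine intervalIntegral.integral_congr_ae (Eventually.of_forall fun t ht => ?_)
    rw [uIoc_of_le hle] at ht
    rw [D.g_eq_state_succ ht.1 ht.2]; rfl
  rw [h, intervalIntegral.integral_const, smul_eq_mul, Tst_succ]
  ring

/-- **Lower bound of the cumulative gradient at the end of stage `k`**:
`∫₀^{T_{k+1}} ‖∇g‖² ≥ (t_k/2) a_{k+1}`. [folklore] -/
theorem mul_a_le_integral (k : ℕ) :
    D.dur k / 2 * D.a (k + 1) ≤ ∫ t in (0 : ℝ)..D.Tst (k + 1), scalarGradNormSq (D.g t) := by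
  have hle : D.Tst k + D.dur k / 2 ≤ D.Tst (k + 1) := (D.Tst_add_half_lt k).le
  have h0 : 0 ≤ D.Tst k + D.dur k / 2 := by linarith [D.Tst_nonneg k, D.dur_pos k]
  calc D.dur k / 2 * D.a (k + 1) ≤ D.dur k / 2 * D.Pg (k + 1) :=
        mul_le_mul_of_nonneg_left (D.a_le_Pg _) (by linarith [D.dur_pos k])
    _ = ∫ t in (D.Tst k + D.dur k / 2)..D.Tst (k + 1), scalarGradNormSq (D.g t) := (D.integral_second_half k).symm
    _ ≤ ∫ t in (0 : ℝ)..D.Tst (k + 1), scalarGradNormSq (D.g t) :=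
        intervalIntegral.integral_mono_interval h0 hle le_rfl
          (Eventually.of_forall fun t => scalarGradNormSq_nonneg _)
          (D.intervalIntegrable_scalarGradNormSq_g (D.Tst_nonneg _) (D.Tst_lt_T _))

/-- `t_k a_{k+1} ≥ T(r-1) a_0 (512 r)^{k+1}`. [folklore] -/
theorem dur_mul_a_succ_ge (k : ℕ) : D.T * (D.r - 1) * D.a 0 * (512 * D.r) ^ (k + 1) ≤ D.dur k * D.a (k + 1) := by
  have h := D.pow_mul_a_zero_le (k + 1)
  have hr := D.r_pos
  have hd : 0 < D.dur k := D.dur_pos k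
  have e : D.dur k * ((512 * D.r ^ 2) ^ (k + 1) * D.a 0) = D.T * (D.r - 1) * D.a 0 * (512 * D.r) ^ (k + 1) := by
    unfold dur
    rw [mul_pow, mul_pow, ← pow_mul]
    have : D.r ^ (2 * (k + 1)) = D.r ^ (k + 1) * D.r ^ (k + 1) := by rw [two_mul, pow_add]
    rw [this]
    field_simp
  rw [← e]
  exact mul_le_mul_of_nonneg_left h hd.le

/-- **The cumulative gradient is unbounded**: for every `B` there is a time `t < T` with
`∫₀ᵗ‖∇g‖² ≥ B`. [cite: DrivasEtAl2022, Lemma 3.2 (3.4) — `∫₀ᵀ‖∇θ‖² = +∞`] -/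
theorem exists_integral_ge (B : ℝ) : ∃ t ∈ Ico 0 D.T, B ≤ ∫ s in (0 : ℝ)..t, scalarGradNormSq (D.g s) := by
  set c : ℝ := D.T * (D.r - 1) * D.a 0 / 2 with hc
  have hc0 : 0 < c := by
    have := D.a_zero_pos; have := D.T_pos; have := D.one_le_r_sub_one
    positivity
  obtain ⟨k, hk⟩ := exists_nat_ge (B / c)
  refine ⟨D.Tst (k + 1), ⟨D.Tst_nonneg _, D.Tst_lt_T _⟩, ?_⟩
  refine le_trans ?_ (D.mul_a_le_integral k)
  have h1 := D.dur_mul_a_succ_ge k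
  have h2 : (k : ℝ) + 1 ≤ (512 * D.r) ^ (k + 1) := by
    have h := one_add_le_pow_of_two_add_nonneg (a := 512 * D.r - 1) (by nlinarith [D.two_le_r]) (k + 1)
    have h' : (1 : ℝ) ≤ 512 * D.r - 1 := by nlinarith [D.two_le_r]
    have e : (1 : ℝ) + (512 * D.r - 1) = 512 * D.r := by ring
    rw [e] at h
    push_cast at h
    have hk0 : (0 : ℝ) ≤ k + 1 := by positivity
    nlinarith [mul_le_mul_of_nonneg_left h' hk0]
  rw [div_le_iff₀ hc0] at hk
  have h3 : c * (k + 1) ≤ D.dur k / 2 * D.a (k + 1) := by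
    have := mul_le_mul_of_nonneg_left h2 hc0.le
    rw [hc] at this ⊢
    nlinarith
  nlinarith

end CascadeData

end DEIJ

end Torus

end Literature.Analysis.FluidPDE
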